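import Summits.CriticalPhenomena.CardyFormulaZ2.Theorems.CardyBoundaryCoulombGasBoundaryDefectGaussianRStubTransportPathsPart29

/-!
# Stub `stub_transportPaths` of line `rainbow-monomials-in-excursion-kernels` — Part 30:
# the route of a clockwise mover: rail facts, separation, jumps, order
# (crux `CardyBoundaryCoulombGas.BoundaryDefectGaussianR`, stmt-CriticalPhenomena-14132)

`tp_cw_facts`: mirror image of Part 29 — the three hypotheses of `tp_mover_bwd` (Part 22) for the
point `m` with `α < mark m` travelling clockwise from its initial rail point (edge `zm m`) down to
its slot (edge `zA ≤ zm m`), the parked points being the slots of the points `i' < m` with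
`α < mark i'` and the initial points of all other points. [folklore]
-/

noncomputable section

open Set Filter Metric Topology Literature.Probability.RandomPlanarGeometry
open Literature.Probability.LatticeModels Literature.Probability.LatticeModels.CollarLegModel
open Summit.CriticalPhenomena.CardyFormulaZ2.Cruxes.RectilinearCardy.ExcursionKernelCovariance

namespace Summit.CriticalPhenomena.CardyFormulaZ2.Cruxes.BoundaryDefectGaussianR.RainbowMonomialsInExcursionKernels

/-- One period back along the parametrisation: `γ (t - 1) = γ t`. [folklore] -/
theorem tp_boundary_sub_one (D : JordanDomain) (t : ℝ) : D.boundary (t - 1) = D.boundary t := by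
  have := D.periodic_boundary (t - 1)
  rw [sub_add_cancel] at this
  exact this.symm

/-- **Registered sub-goal `s7_boundarySubOne` of stub `stub_transportPaths`** (one period back,
one-line form of `tp_boundary_sub_one`; `tp_cw_facts` exceeds the cap). [folklore] -/
theorem s7_boundarySubOne : ∀ (D : Literature.Probability.RandomPlanarGeometry.JordanDomain) (t : ℝ), D.boundary (t - 1) = D.boundary t :=
  fun D t => tp_boundary_sub_one D t

set_option maxHeartbeats 4000000 in
/-- **Route facts of a clockwise mover.** See the module docstring. [folklore] -/
theorem tp_cw_facts {k : ℕ} (D : MarkedDomain k) {M : ℕ} {c : ℤ → ℝ} {a τ : ℤ → ℕ}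
    (hcmono : StrictMono c) (hcper : ∀ z, c (z + M) = c z + 1)
    (ha4 : ∀ z, a z < 4) (hτ : ∀ z, τ z = 1 ∨ τ z = 3)
    (hmodτ : ∀ z, (a z + τ z) % 4 = (a (z - 1) + 2) % 4)
    (hdir : ∀ z, ∀ t ∈ Icc (c z) (c (z + 1)), D.boundary t =
      D.boundary (c z) + ((‖D.boundary t - D.boundary (c z)‖ : ℝ) : ℂ) * Complex.I ^ (a z))
    (hmono : ∀ z, StrictMonoOn (fun t => ‖D.boundary t - D.boundary (c z)‖) (Icc (c z) (c (z + 1))))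
    (hash : ∀ (z n : ℤ), a (z + n * M) = a z)
    {κ₀ : ℝ} (hκ₀ : ∀ z z' : ℤ, z + 2 ≤ z' → z' ≤ z + M - 2 →
      ∀ t ∈ Icc (c z) (c (z + 1)), ∀ t' ∈ Icc (c z') (c (z' + 1)),
        κ₀ ≤ dist (D.boundary t) (D.boundary t'))
    {δ ρ r s₀ : ℝ} (hδ : 0 < δ) (hρδ : 64 * δ ≤ ρ) (hρr : ρ ≤ r) (hs₀ : 0 < s₀)
    {V : Finset (ℤ × ℤ)} (K : ℤ → Fin 4) (hK : ∀ z, K z = Fin.ofNat 4 (a z)) (Y : ℤ → ℤ)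
    (hY : ∀ z, Y z = ⌈(D.boundary (c z) * (-Complex.I) ^ (a z)).im / δ⌉) (xon xoff : ℤ → ℤ)
    (Fl : ℤ × ℤ → Prop) (Sep JumpOK : ℤ × ℤ → ℤ × ℤ → Prop)
    (hSep : ∀ u v, Sep u v ↔ (r / δ) ^ 2 ≤ ((((u.1 - v.1) ^ 2 + (u.2 - v.2) ^ 2 : ℤ)) : ℝ))
    (hJ : ∀ u v, JumpOK u v → JumpOK v u)
    (hA : ∀ (z x : ℤ), δ * ((⌈ρ / 4 / δ⌉₊ : ℕ) + 1) ≤ δ * x - (D.boundary (c z) * (-Complex.I) ^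
      (a z)).re → δ * x - (D.boundary (c z) * (-Complex.I) ^ (a z)).re ≤ ‖D.boundary (c (z + 1)) -
      D.boundary (c z)‖ - δ * ((⌈ρ / 4 / δ⌉₊ : ℕ) + 1) → Fl ((x) • dir (K (z)) + Y (z) • dir (K
      (z) + 1)) ∧ ((x) • dir (K (z)) + Y (z) • dir (K (z) + 1)) ∈ V ∧ ((x) • dir (K (z)) + Y (z) •
      dir (K (z) + 1)) + dir (K (z) + 3) ∉ V ∧ ((neighbours ((x) • dir (K (z)) + Y (z) • dir (K
      (z) + 1))).filter (fun w ↦ w ∉ V)).card = 1 ∧ outDart V ((x) • dir (K (z)) + Y (z) • dir (K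
      (z) + 1)) = some (((x) • dir (K (z)) + Y (z) • dir (K (z) + 1)), K (z) + 3))
    (hB : ∀ z : ℤ, JumpOK ((xoff z) • dir (K ((z - 1))) + Y ((z - 1)) • dir (K ((z - 1)) + 1))
      ((xon z) • dir (K (z)) + Y (z) • dir (K (z) + 1)) ∧ (∃ g : ℕ, (dsucc V)^[g] (((xoff z) • dir
      (K ((z - 1))) + Y ((z - 1)) • dir (K ((z - 1)) + 1)), K (z - 1) + 3) = (((xon z) • dir (K
      (z)) + Y (z) • dir (K (z) + 1)), K z + 3)) ∧ (δ * ((((⌈ρ / 4 / δ⌉₊ + 3 : ℕ) : ℝ)) - 1) ≤ δ *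
      (xon z : ℤ) - (D.boundary (c z) * (-Complex.I) ^ (a z)).re ∧ δ * (xon z : ℤ) - (D.boundary
      (c z) * (-Complex.I) ^ (a z)).re ≤ δ * ((((⌈ρ / 4 / δ⌉₊ + 3 : ℕ) : ℝ)) + 1)) ∧ (‖D.boundary
      (c ((z - 1) + 1)) - D.boundary (c (z - 1))‖ - δ * ((((⌈ρ / 4 / δ⌉₊ + 3 : ℕ) : ℝ)) + 1) ≤ δ *
      (xoff z : ℤ) - (D.boundary (c (z - 1)) * (-Complex.I) ^ (a (z - 1))).re ∧ δ * (xoff z : ℤ) -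
      (D.boundary (c (z - 1)) * (-Complex.I) ^ (a (z - 1))).re ≤ ‖D.boundary (c ((z - 1) + 1)) -
      D.boundary (c (z - 1))‖ - δ * ((((⌈ρ / 4 / δ⌉₊ + 3 : ℕ) : ℝ)) - 1)))
    (zm : Fin k → ℤ) (hzm : ∀ i, D.mark i ∈ Ioo (c (zm i)) (c (zm i + 1))) {α : ℝ} {zA : ℤ}
    (hzA0 : a zA = 0) (hαA : α ∈ Ioo (c zA) (c (zA + 1))) (hα0 : 0 ≤ α)
    {η₀ κ₁ dmm dA dmc dAc Λ ℓmin : ℝ} (hη₀ : 0 < η₀)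
    (hκ₁ : ∀ s t : ℝ, (∀ n : ℤ, η₀ ≤ |s - t - n|) → κ₁ ≤ dist (D.boundary s) (D.boundary t))
    (hgap1 : ∀ i i', i ≠ i' → ∀ n : ℤ, 2 * η₀ ≤ |D.mark i - D.mark i' - n|)
    (hgap2 : ∀ i, ∀ n : ℤ, 2 * η₀ ≤ |α - D.mark i - n|)
    (hdmm : ∀ i i', i ≠ i' → dmm ≤ dist (D.pt i) (D.pt i'))
    (hdA : ∀ i, dA ≤ dist (D.boundary α) (D.pt i))
    (hdmc : ∀ i, dmc ≤ ‖D.pt i - D.boundary (c (zm i))‖ ∧ dmc ≤ ‖D.boundary (c (zm i + 1)) - D.pt i‖)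
    (hdAc : dAc ≤ ‖D.boundary α - D.boundary (c zA)‖ ∧ dAc ≤ ‖D.boundary (c (zA + 1)) - D.boundary α‖)
    (hΛ : ∀ z, ‖D.boundary (c (z + 1)) - D.boundary (c z)‖ ≤ Λ)
    (hℓmin : ∀ z, ℓmin ≤ ‖D.boundary (c (z + 1)) - D.boundary (c z)‖)
    (hrκ₀ : 16 * r ≤ κ₀) (hrκ₁ : 16 * r ≤ κ₁) (hrdmm : 16 * r ≤ dmm) (hrdA : 16 * r ≤ dA)
    (hrdmc : 16 * r ≤ dmc) (hrdAc : 16 * r ≤ dAc) (hrℓ : 16 * r ≤ ℓmin) (hs₀A : 4 * s₀ ≤ dA)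
    (hs₀Ac : 4 * s₀ ≤ dAc)
    (p : Fin k → ℤ × ℤ) (xi : Fin k → ℤ)
    (hp_eq : ∀ i, p i = (xi i) • dir (K (zm i)) + Y (zm i) • dir (K (zm i) + 1))
    (hp_coord : ∀ i, |δ * (xi i : ℤ) - ((D.boundary (c (zm i)) * (-Complex.I) ^ (a (zm i))).re +
      ‖D.pt i - D.boundary (c (zm i))‖)| ≤ r / 4)
    (x : Fin k → ℤ) (hxmono : StrictMono x)
    (hxsep : ∀ i₁ i₂ : Fin k, i₁ ≠ i₂ → (r / δ) ^ 2 ≤ (((x i₁ - x i₂) ^ 2 : ℤ) : ℝ))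
    (hxs₀ : ∀ i, |δ * (x i : ℤ)| ≤ s₀) (an1 : ℤ)
    (han1 : (D.boundary α).re - δ < δ * an1 ∧ δ * an1 ≤ (D.boundary α).re)
    (m : Fin k) (hm : α < D.mark m) (P : Fin k → ℤ × ℤ)
    (hP : ∀ i', i' ≠ m → (α < D.mark i' → i' < m → P i' = (an1 + x i') • dir (K zA) + Y zA • dir (K zA + 1)) ∧
      (¬ (α < D.mark i' ∧ i' < m) → P i' = p i')) :
    (∀ (z xx : ℤ), zA ≤ z → z ≤ zm m → (z = zm m → xx ≤ xi m) → (z ≠ zm m → xx ≤ xoff (z + 1)) →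
      (z = zA → an1 + x m ≤ xx) → (z ≠ zA → xon z ≤ xx) → (Fl ((xx) • dir (K (z)) + Y (z) • dir (K
      (z) + 1)) ∧ (∀ i', i' ≠ m → Sep ((xx) • dir (K (z)) + Y (z) • dir (K (z) + 1)) (P i') ∧ Sep
      (P i') ((xx) • dir (K (z)) + Y (z) • dir (K (z) + 1))) ∧ ((xx) • dir (K (z)) + Y (z) • dir
      (K (z) + 1)) ∈ V ∧ ((xx) • dir (K (z)) + Y (z) • dir (K (z) + 1)) + dir (K (z) + 3) ∉ V ∧
      ((neighbours ((xx) • dir (K (z)) + Y (z) • dir (K (z) + 1))).filter (fun w ↦ w ∉ V)).card =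
      1 ∧ outDart V ((xx) • dir (K (z)) + Y (z) • dir (K (z) + 1)) = some (((xx) • dir (K (z)) + Y
      (z) • dir (K (z) + 1)), K (z) + 3))) ∧
    (∀ z : ℤ, zA < z → z ≤ zm m → JumpOK ((xon z) • dir (K (z)) + Y (z) • dir (K (z) + 1)) ((xoff
      z) • dir (K ((z - 1))) + Y ((z - 1)) • dir (K ((z - 1)) + 1)) ∧ ∃ g : ℕ, (dsucc V)^[g]
      (((xoff z) • dir (K ((z - 1))) + Y ((z - 1)) • dir (K ((z - 1)) + 1)), K (z - 1) + 3) =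
      (((xon z) • dir (K (z)) + Y (z) • dir (K (z) + 1)), K z + 3)) ∧
    ((zm m = zA → an1 + x m ≤ xi m ∧ xi m - (an1 + x m) ≤ ((⌈Λ / δ⌉₊ + 2 : ℕ) : ℤ)) ∧ (zA < zm m →
      xon (zm m) ≤ xi m ∧ xi m - xon (zm m) ≤ ((⌈Λ / δ⌉₊ + 2 : ℕ) : ℤ)) ∧ (∀ z : ℤ, zA < z → z <
      zm m → xon z ≤ xoff (z + 1) ∧ xoff (z + 1) - xon z ≤ ((⌈Λ / δ⌉₊ + 2 : ℕ) : ℤ)) ∧ (zA < zm m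
      → an1 + x m ≤ xoff (zA + 1) ∧ xoff (zA + 1) - (an1 + x m) ≤ ((⌈Λ / δ⌉₊ + 2 : ℕ) : ℤ))) := by
  have hr : 0 < r := by linarith
  have hδr : 64 * δ ≤ r := hρδ.trans hρr
  have hpt : ∀ i, D.pt i = D.boundary (D.mark i) := fun i => rfl
  have hczlt : ∀ z : ℤ, c z < c (z + 1) := fun z => hcmono (by omega)
  have hmρ : δ * (((⌈ρ / 4 / δ⌉₊ : ℕ) : ℝ) + 1) < ρ / 4 + 2 * δ := tp_radius_margin hδ (by linarith)
  have hmρ' : δ * (((⌈ρ / 4 / δ⌉₊ : ℕ) : ℝ) + 1) ≤ r / 2 := by linarith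
  have hJ1 : δ * ((((⌈ρ / 4 / δ⌉₊ + 3 : ℕ) : ℝ)) + 1) ≤ r / 2 := by
    push_cast; rw [show δ * ((⌈ρ / 4 / δ⌉₊ : ℝ) + 3 + 1) = δ * ((⌈ρ / 4 / δ⌉₊ : ℝ) + 1) + 3 * δ by ring]
    linarith
  have hJ2 : δ * (((⌈ρ / 4 / δ⌉₊ : ℕ) : ℝ) + 1) ≤ δ * ((((⌈ρ / 4 / δ⌉₊ + 3 : ℕ) : ℝ)) - 1) := by
    push_cast; rw [show δ * ((⌈ρ / 4 / δ⌉₊ : ℝ) + 3 - 1) = δ * ((⌈ρ / 4 / δ⌉₊ : ℝ) + 1) + δ by ring]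
    linarith
  have hJ3 : 0 ≤ δ * ((((⌈ρ / 4 / δ⌉₊ + 3 : ℕ) : ℝ)) - 1) :=
    mul_nonneg hδ.le (by push_cast; linarith [(Nat.cast_nonneg _ : (0 : ℝ) ≤ (⌈ρ / 4 / δ⌉₊ : ℕ))])
  have hW1 : ∀ u v : ℤ, ∀ z : ℤ, 0 ≤ δ * u - (D.boundary (c z) * (-Complex.I) ^ (a z)).re →
      δ * v - (D.boundary (c z) * (-Complex.I) ^ (a z)).re ≤ ‖D.boundary (c (z + 1)) - D.boundary (c z)‖ →
      v - u ≤ ((⌈Λ / δ⌉₊ + 2 : ℕ) : ℤ) := by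
    intro u v z hu hv
    have h1 : δ * ((v : ℝ) - u) ≤ Λ := by have := hΛ z; rw [mul_sub]; linarith
    have h2 : (v : ℝ) - u ≤ Λ / δ := by rw [le_div_iff₀ hδ]; linarith
    have : ((v - u : ℤ) : ℝ) ≤ ((⌈Λ / δ⌉₊ + 2 : ℕ) : ℤ) := by
      push_cast; linarith [(Nat.le_ceil _ : Λ / δ ≤ (⌈Λ / δ⌉₊ : ℕ))]
    exact_mod_cast this
  have hdiv : ∀ u v : ℤ, δ * (u : ℝ) ≤ δ * (v : ℝ) → u ≤ v := fun u v h => by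
    exact_mod_cast (le_of_mul_le_mul_left h hδ : (u : ℝ) ≤ v)
  have hzs := hzm m
  set sm := ‖D.pt m - D.boundary (c (zm m))‖ with hsm
  obtain ⟨-, -, hsmℓ⟩ := tp_inside_dist D.toJordanDomain hcmono hdir hmono (zm m) hzs
  have hdm := hdmc m
  rw [← hpt] at hsmℓ
  change ‖D.boundary (c ((zm m) + 1)) - D.pt m‖ = ‖D.boundary (c ((zm m) + 1)) - D.boundary (c (zm m))‖ - sm
    at hsmℓ
  rw [hsmℓ] at hdm
  have hinit := fun i => abs_le.1 (hp_coord i)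
  set sα := ‖D.boundary α - D.boundary (c zA)‖ with hsα
  obtain ⟨-, -, hsαℓ⟩ := tp_inside_dist D.toJordanDomain hcmono hdir hmono zA hαA
  change ‖D.boundary (c (zA + 1)) - D.boundary α‖ = ‖D.boundary (c (zA + 1)) - D.boundary (c zA)‖ - sα
    at hsαℓ
  have hdAc' := hdAc
  rw [hsαℓ] at hdAc'
  have hA0 : (D.boundary (c zA) * (-Complex.I) ^ (a zA)).re = (D.boundary (c zA)).re := by
    rw [hzA0, pow_zero, mul_one]
  have hαre : (D.boundary α).re = (D.boundary (c zA)).re + sα := by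
    have h := hdir zA α ⟨hαA.1.le, hαA.2.le⟩
    rw [hzA0, pow_zero, mul_one] at h
    rw [h, Complex.add_re, Complex.ofReal_re]
  have hslot_s : ∀ i, sα - δ - s₀ ≤ δ * ((an1 + x i : ℤ) : ℝ) - (D.boundary (c zA) * (-Complex.I) ^ (a zA)).re ∧
      δ * ((an1 + x i : ℤ) : ℝ) - (D.boundary (c zA) * (-Complex.I) ^ (a zA)).re ≤ sα + s₀ := by
    intro i
    have hx := abs_le.1 (hxs₀ i)
    rw [hA0]; push_cast
    constructor <;> linarith [han1.1, han1.2, hαre]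
  have hzAs : zA ≤ zm m := by
    by_contra h
    have := hcmono.monotone (show zm m + 1 ≤ zA by omega); linarith [hαA.1, hzs.2, hm]
  have hzsA : zm m ≤ zA + M := by
    by_contra h
    have h1 := hcmono.monotone (show zA + 1 + M ≤ zm m by omega)
    have h2 := hcper (zA + 1); linarith [hαA.2, hzs.1, (D.mark_mem m).2, hα0]
  have hxgap : ∀ i', i' < m → r / δ ≤ ((x m - x i' : ℤ) : ℝ) := fun i' hi' =>
    tp_slot_gap hδ hr.le (hxmono hi') (hxsep m i' hi'.ne')
  refine ⟨?_, fun z hz1 hz2 => ⟨hJ _ _ (hB z).1, (hB z).2.1⟩, ?_⟩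
  · intro z xx hz1 hz2 hhi1 hhi2 hlo1 hlo2
    have hlow : δ * (((⌈ρ / 4 / δ⌉₊ : ℕ) : ℝ) + 1) ≤ δ * xx - (D.boundary (c z) * (-Complex.I) ^ (a z)).re := by
      by_cases hzz : z = zA
      · have h := hlo1 hzz
        rw [hzz]
        have h' : δ * ((an1 + x m : ℤ) : ℝ) ≤ δ * (xx : ℝ) :=
          mul_le_mul_of_nonneg_left (by exact_mod_cast h) hδ.le
        linarith [(hslot_s m).1, hdAc.1]
      · have h := hlo2 hzz
        have h' : δ * (xon z : ℝ) ≤ δ * (xx : ℝ) :=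
          mul_le_mul_of_nonneg_left (by exact_mod_cast h) hδ.le
        linarith [(hB z).2.2.1.1]
    have hhigh : δ * xx - (D.boundary (c z) * (-Complex.I) ^ (a z)).re ≤
        ‖D.boundary (c (z + 1)) - D.boundary (c z)‖ - δ * (((⌈ρ / 4 / δ⌉₊ : ℕ) : ℝ) + 1) := by
      by_cases hzz : z = zm m
      · have h := hhi1 hzz
        rw [hzz]
        have h' : δ * (xx : ℝ) ≤ δ * (xi m : ℝ) :=
          mul_le_mul_of_nonneg_left (by exact_mod_cast h) hδ.le
        linarith [(hinit m).2, hdm.2]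
      · have h := hhi2 hzz
        have hBz := hB (z + 1)
        simp only [add_sub_cancel_right] at hBz
        have h' : δ * (xx : ℝ) ≤ δ * (xoff (z + 1) : ℝ) :=
          mul_le_mul_of_nonneg_left (by exact_mod_cast h) hδ.le
        linarith [hBz.2.2.2.2]
    obtain ⟨hFl, hrailfacts⟩ := hA z xx hlow hhigh
    refine ⟨hFl, ?_, hrailfacts⟩
    intro i' hi'
    obtain ⟨hP1, hP2⟩ := hP i' hi'
    have hm0 : 0 ≤ δ * (((⌈ρ / 4 / δ⌉₊ : ℕ) : ℝ) + 1) := by positivity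
    have hs0 : 0 ≤ δ * xx - (D.boundary (c z) * (-Complex.I) ^ (a z)).re := hm0.trans hlow
    have hsℓ : δ * xx - (D.boundary (c z) * (-Complex.I) ^ (a z)).re ≤
        ‖D.boundary (c (z + 1)) - D.boundary (c z)‖ := by linarith
    by_cases hlt : α < D.mark i' ∧ i' < m
    · rw [hP1 hlt.1 hlt.2]
      by_cases hzz : z = zA
      · -- same rail, slots behind
        have h := hlo1 hzz
        rw [hzz]
        have key := tp_sep_same_rail hδ hr.le (K zA) (Y zA) xx (an1 + x i') (by
          have hg := hxgap i' hlt.2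
          have h1 : ((an1 + x m : ℤ) : ℝ) ≤ (xx : ℝ) := by exact_mod_cast h
          have h0 : (0 : ℝ) ≤ r / δ := by positivity
          push_cast at h1 hg ⊢
          rw [abs_of_nonneg (by linarith)]
          linarith)
        rw [hSep, hSep]
        exact ⟨key, tp_sep_symm _ _ key⟩
      · have hzlt : zA < z := lt_of_le_of_ne hz1 (Ne.symm hzz)
        by_cases hzw : z = zA + M
        · -- the wrap case: the start edge is the anchor edge, the slots are ahead
          have hzzs : z = zm m := le_antisymm hz2 (by omega)
          have hzw' : z = zA + 1 * M := by rw [hzw]; ring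
          have haz : a z = a zA := by rw [hzw', hash]
          have hcz' : D.boundary (c z) = D.boundary (c zA) := by
            rw [hzw']; exact tp_point_shift D.toJordanDomain hcper zA 1
          have hKz : K z = K zA := by rw [hK, hK, haz]
          have hYz : Y z = Y zA := by rw [hY, hY, haz, hcz']
          have hAz : (D.boundary (c z) * (-Complex.I) ^ (a z)).re =
              (D.boundary (c zA) * (-Complex.I) ^ (a zA)).re := by rw [haz, hcz']
          have hmk1 : D.mark m - 1 ∈ Ioo (c zA) (c (zA + 1)) := by
            have h1 := hzs.1
            have h2 := hzs.2
            rw [← hzzs, hzw] at h1 h2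
            rw [hcper] at h1
            rw [show zA + (M : ℤ) + 1 = (zA + 1) + M by ring, hcper] at h2
            exact ⟨by linarith, by linarith⟩
          have hper : D.boundary (D.mark m - 1) = D.pt m := by
            rw [hpt]; exact tp_boundary_sub_one D.toJordanDomain _
          have hsm' : ‖D.pt m - D.boundary (c zA)‖ = sm := by rw [hsm, ← hzzs, hcz']
          have hdist := tp_same_edge_dist D.toJordanDomain hdir zA ⟨hαA.1.le, hαA.2.le⟩
            ⟨hmk1.1.le, hmk1.2.le⟩
          have hlt2 : ‖D.boundary (D.mark m - 1) - D.boundary (c zA)‖ < sα :=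
            hmono zA ⟨hmk1.1.le, hmk1.2.le⟩ ⟨hαA.1.le, hαA.2.le⟩ (by linarith [(D.mark_mem m).2])
          change dist (D.boundary α) (D.boundary (D.mark m - 1)) =
            |sα - ‖D.boundary (D.mark m - 1) - D.boundary (c zA)‖| at hdist
          rw [abs_of_pos (by linarith), hper, hsm'] at hdist
          rw [hper] at hlt2
          have hdA' := hdA m
          rw [hdist] at hdA'
          have hxx : δ * (xx : ℝ) ≤ δ * (xi m : ℝ) :=
            mul_le_mul_of_nonneg_left (by exact_mod_cast hhi1 hzzs) hδ.le
          have hi2 := (hinit m).2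
          rw [← hzzs] at hi2
          rw [hAz, hcz', hsm'] at hi2
          rw [hKz, hYz]
          have key := tp_sep_same_rail hδ hr.le (K zA) (Y zA) xx (an1 + x i') (by
            have hs1 := (hslot_s i').1
            push_cast at hs1 hi2 hxx ⊢
            have hge : r ≤ δ * ((an1 + x i' : ℝ) - xx) := by
              rw [mul_sub]; linarith [hdA', hxx, hs₀A, hrdA]
            rw [abs_sub_comm, abs_of_nonneg (by nlinarith), div_le_iff₀ hδ]
            linarith)
          rw [hSep, hSep]
          exact ⟨key, tp_sep_symm _ _ key⟩
        · -- another edge: far from the anchor edge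
          have hzle : z < zA + M := lt_of_le_of_ne (by omega) hzw
          rw [hSep, hSep, hK z, hK zA, hY z, hY zA]
          refine tp_sep_rail_points D.toJordanDomain hcmono ha4 hdir hδ hr.le z xx zA (an1 + x i') hs0 hsℓ
            (by linarith [(hslot_s i').1, hdAc.1]) (by linarith [(hslot_s i').2, hdAc'.2]) ?_
          intro t ht tw htw hnt hntw
          have key := tp_slot_dist D.toJordanDomain hcmono hcper ha4 hτ hmodτ hdir hmono hash hκ₀ zA z
            (by omega) (by omega) htw ht
          rw [hntw] at key
          have hfar : ‖D.boundary (c (zA + 1)) - D.boundary tw‖ =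
              ‖D.boundary (c (zA + 1)) - D.boundary (c zA)‖ -
                (δ * ((an1 + x i' : ℤ) : ℝ) - (D.boundary (c zA) * (-Complex.I) ^ (a zA)).re) := by
            have h := tp_same_edge_dist D.toJordanDomain hdir zA ⟨(hczlt zA).le, le_rfl⟩ htw
            rw [dist_eq_norm] at h
            rw [h, hntw, abs_of_nonneg (by linarith [(hslot_s i').2, hdAc'.2])]
          rw [hfar] at key
          have hmin : r + 2 * δ ≤ min κ₀ (min (δ * ((an1 + x i' : ℤ) : ℝ) -
              (D.boundary (c zA) * (-Complex.I) ^ (a zA)).re)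
              (‖D.boundary (c (zA + 1)) - D.boundary (c zA)‖ -
                (δ * ((an1 + x i' : ℤ) : ℝ) - (D.boundary (c zA) * (-Complex.I) ^ (a zA)).re))) := by
            refine le_min (by linarith) (le_min ?_ ?_)
            · linarith [(hslot_s i').1, hdAc.1]
            · linarith [(hslot_s i').2, hdAc'.2]
          exact hmin.trans key
    · rw [hP2 hlt]
      have hne : m ≠ i' := Ne.symm hi'
      rw [hp_eq i', hSep, hSep, hK z, hK (zm i'), hY z, hY (zm i')]
      have hzi := hzm i'
      set si := ‖D.pt i' - D.boundary (c (zm i'))‖ with hsi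
      obtain ⟨-, -, hsiℓ⟩ := tp_inside_dist D.toJordanDomain hcmono hdir hmono (zm i') hzi
      have hdi := hdmc i'
      rw [← hpt] at hsiℓ
      change ‖D.boundary (c (zm i' + 1)) - D.pt i'‖ =
        ‖D.boundary (c (zm i' + 1)) - D.boundary (c (zm i'))‖ - si at hsiℓ
      rw [hsiℓ] at hdi
      refine tp_sep_rail_points D.toJordanDomain hcmono ha4 hdir hδ hr.le z xx (zm i') (xi i') hs0 hsℓ
        (by linarith [(hinit i').1, hdi.1]) (by linarith [(hinit i').2, hdi.2]) ?_
      intro t ht t' ht' hnt hnt'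
      have h1 : dist (D.boundary (D.mark i')) (D.boundary t') ≤ r / 4 := by
        rw [tp_same_edge_dist D.toJordanDomain hdir (zm i') ⟨hzi.1.le, hzi.2.le⟩ ht', hnt', ← hpt]
        rw [abs_le]; constructor <;> linarith [(hinit i').1, (hinit i').2]
      have hout : ∀ n : ℤ, D.mark i' + n ∉ Ioo α (D.mark m) := by
        intro n hn
        rcases lt_trichotomy n 0 with hn0 | rfl | hn0
        · have : (n : ℝ) ≤ -1 := by exact_mod_cast (show n ≤ -1 by omega)
          linarith [hn.1, (D.mark_mem i').2]
        · simp only [Int.cast_zero, add_zero] at hn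
          rcases lt_or_ge m i' with h | h
          · linarith [D.strictMono_mark h, hn.2]
          · exact hlt ⟨hn.1, lt_of_le_of_ne h (Ne.symm hne)⟩
        · linarith [hn.2, (D.mark_mem i').1, (D.mark_mem m).2, (by exact_mod_cast hn0 : (1 : ℝ) ≤ n)]
      have hregime : t ∈ Icc α (D.mark m) ∨ dist (D.boundary t) (D.boundary α) ≤ δ + s₀ ∨
          dist (D.boundary t) (D.boundary (D.mark m)) ≤ r / 4 := by
        by_cases ht1 : D.mark m < t
        · right; right
          have hzz : z = zm m := by
            by_contra hne'
            have := hcmono.monotone (show z + 1 ≤ zm m by omega); linarith [ht.2, hzs.1]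
          subst hzz
          have hxx := hhi1 rfl
          rw [tp_same_edge_dist D.toJordanDomain hdir (zm m) ht ⟨hzs.1.le, hzs.2.le⟩, hnt, ← hpt]
          have hlt3 : sm < δ * ↑xx - (D.boundary (c (zm m)) * (-Complex.I) ^ a (zm m)).re :=
            by rw [← hnt]; exact hmono (zm m) ⟨hzs.1.le, hzs.2.le⟩ ht ht1
          have h4 : δ * (xx : ℝ) ≤ δ * (xi m : ℝ) :=
            mul_le_mul_of_nonneg_left (by exact_mod_cast hxx) hδ.le
          rw [abs_le]; constructor <;> linarith [(hinit m).2]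
        · by_cases ht2 : t < α
          · right; left
            have hzz : z = zA := by
              by_contra hne'
              have := hcmono.monotone (show zA + 1 ≤ z by omega); linarith [ht.1, hαA.2]
            have hxx := hlo1 hzz
            rw [hzz] at ht hnt
            rw [tp_same_edge_dist D.toJordanDomain hdir zA ht ⟨hαA.1.le, hαA.2.le⟩, hnt]
            change |δ * ↑xx - (D.boundary (c zA) * (-Complex.I) ^ a zA).re - sα| ≤ δ + s₀
            have hlt3 : δ * ↑xx - (D.boundary (c zA) * (-Complex.I) ^ a zA).re < sα := by
              rw [← hnt]; exact hmono zA ht ⟨hαA.1.le, hαA.2.le⟩ ht2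
            have h4 : δ * ((an1 + x m : ℤ) : ℝ) ≤ δ * (xx : ℝ) :=
              mul_le_mul_of_nonneg_left (by exact_mod_cast hxx) hδ.le
            rw [abs_le]; constructor <;> linarith [(hslot_s m).1]
          · left; exact ⟨not_lt.1 ht2, not_lt.1 ht1⟩
      have h2 := tp_sep_regimes D.boundary hη₀ hκ₁ (hgap2 i') (hgap1 m i' hne) hout
        (θ₁ := δ + s₀) (θ₂ := r / 4) (hdA i') (hdmm m i' hne) (q := D.boundary t) rfl hregime
      rw [← hpt] at h2 h1
      rw [dist_comm] at h1
      have h3 := dist_triangle (D.boundary t) (D.boundary t') (D.pt i')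
      have hmin : r + 2 * δ + r / 4 ≤ min κ₁ (min (dA - (δ + s₀)) (dmm - r / 4)) :=
        le_min (by linarith) (le_min (by linarith) (by linarith))
      linarith
  · refine ⟨fun hzz => ?_, fun hlt => ?_, fun z hz1 hz2 => ?_, fun hlt => ?_⟩
    · -- single edge: the slot is behind the initial point by ≥ dA
      have hsm' : ‖D.pt m - D.boundary (c zA)‖ = sm := by rw [hsm, hzz]
      have hdist := tp_same_edge_dist D.toJordanDomain hdir zA (t₁ := D.mark m)
        (by rw [← hzz]; exact ⟨hzs.1.le, hzs.2.le⟩) ⟨hαA.1.le, hαA.2.le⟩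
      have hlt2 : sα < sm := by
        rw [← hsm', hpt]
        exact hmono zA ⟨hαA.1.le, hαA.2.le⟩ (by rw [← hzz]; exact ⟨hzs.1.le, hzs.2.le⟩) hm
      rw [← hpt, hsm', abs_of_pos (by linarith)] at hdist
      have hdA' := hdA m
      rw [dist_comm, hdist] at hdA'
      have hi := hinit m
      rw [hzz] at hi
      rw [hsm'] at hi
      have hdm' := hdm
      rw [hzz] at hdm'
      constructor
      · apply hdiv; linarith [hi.1, (hslot_s m).2]
      · exact hW1 _ _ zA (by linarith [(hslot_s m).1, hdAc.1]) (by linarith [hi.2, hdm'.2])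
    · constructor
      · apply hdiv; linarith [(hinit m).1, hdm.1, (hB (zm m)).2.2.1.2]
      · exact hW1 _ _ (zm m) (by linarith [(hB (zm m)).2.2.1.1]) (by linarith [(hinit m).2, hdm.2])
    · have hBz := hB (z + 1)
      simp only [add_sub_cancel_right] at hBz
      constructor
      · apply hdiv; linarith [(hB z).2.2.1.2, hBz.2.2.2.1, hℓmin z]
      · exact hW1 _ _ z (by linarith [(hB z).2.2.1.1]) (by linarith [hBz.2.2.2.2])
    · have hBz := hB (zA + 1)
      simp only [add_sub_cancel_right] at hBz
      constructor
      · apply hdiv; linarith [(hslot_s m).2, hdAc'.2, hBz.2.2.2.1]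
      · exact hW1 _ _ zA (by linarith [(hslot_s m).1, hdAc.1]) (by linarith [hBz.2.2.2.2])

end Summit.CriticalPhenomena.CardyFormulaZ2.Cruxes.BoundaryDefectGaussianR.RainbowMonomialsInExcursionKernels

end
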